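import Literature.NumberTheory.LFunctions.ClassGroupLFunctionFunctionalEquation
import HarnessLib

/-!
# The functional equation of a class group `L`-function in closed form: `Λ(1 − s, χ) = χ([𝔡]) Λ(s, χ̄)`

Topic `Literature/NumberTheory/LFunctions` (namespace `Literature.NumberTheory.LFunctions.NumberField`),
continuing `ClassGroupLFunctionFunctionalEquation.lean`, whose functional equation
`Λ_a(1 − s) = Λ_{a ∘ σ⁻¹}(s)` hides the duality permutation `σ` of the class group behind an
existential quantifier.  Here we make it explicit — Neukirch's pairing `𝔎 𝔎' = [𝔡]`, VII (5.9):
`σ(C) = [𝔡_K] · C⁻¹`, `𝔡_K` the different — and obtain the functional equation of the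
`L`-function of a class group character in its classical closed form (Neukirch VII (8.6) with
`𝔪 = 1`: root number `W(χ) = χ(𝔡)`, `|W(χ)| = 1`; [ThornerZaman2019, (2.6)]):

* `differentClass K = [𝔡_K] ∈ Cl_K` (a definition with body) and `dualityPerm K`, the
  involution `C ↦ [𝔡_K] C⁻¹` of `Cl_K` (definition with body, `dualityPerm_apply`,
  `dualityPerm_symm`);
* `exists_dual_classRep_eq` — for the representatives `J_C` of `C⁻¹` (`classRep`):
  `dual(J_C) = (v_C) · J_{σ C}` with `σ = dualityPerm K`, and the norm relation
  `𝔑(J_{σC}) |d_K| 𝔑(J_C) |N(v_C)| = 1` (the tree's `exists_classDuality`, now for THE explicit `σ`);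
* `completedClassTwistedZeta_one_sub` — `Λ_a(1 − s) = Λ_{a ∘ σ}(s)` off the integers, for every
  coefficient function `a` (proof of the tree's `exists_perm_completedClassTwistedZeta_one_sub`
  verbatim, with the explicit `σ`);
* `completedClassGroupLFunction_one_sub` — **`Λ(1 − s, χ) = χ([𝔡_K]) · Λ(s, χ⁻¹)`** off the
  integers, `Λ(s, χ) = |d_K|^{s/2} Γ_ℝ(s)^{r₁} Γ_ℂ(s)^{r₂} L(s, χ)`; `norm_rootNumber`:
  `|χ([𝔡_K])| = 1`.

## References

* J. Neukirch, *Algebraic Number Theory*, Springer 1999, Ch. VII (5.9)–(5.10), (8.6).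
  [NeukirchANT1999]
* J. Thorner, A. Zaman, *A unified and improved Chebotarev density theorem*, ANT 13 (2019), §2.3
  (2.6). [ThornerZaman2019]
-/

noncomputable section

open scoped NumberField nonZeroDivisors
open NumberField NumberField.InfinitePlace NumberField.Units Complex Filter Topology Set

namespace Literature.NumberTheory.LFunctions.NumberField

variable (K : Type*) [Field K] [NumberField K]

/-! ### The class of the different and the duality involution -/

/-- The different of `𝓞 K / ℤ` is a nonzero ideal (its fractional ideal is `(dual 1)⁻¹`). [folklore] -/
theorem differentIdeal_int_ne_bot : differentIdeal ℤ (𝓞 K) ≠ ⊥ := by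
  have h : ((differentIdeal ℤ (𝓞 K) : Ideal (𝓞 K)) : FractionalIdeal (𝓞 K)⁰ K) ≠ 0 := by
    rw [coeIdeal_differentIdeal ℤ ℚ]
    exact inv_ne_zero (FractionalIdeal.dual_ne_zero ℤ ℚ one_ne_zero)
  exact fun hb ↦ h (by rw [hb, FractionalIdeal.coeIdeal_bot])

/-- **The ideal class of the different** `[𝔡_K] ∈ Cl_K`. [cite: NeukirchANT1999, Ch. VII (5.9)] -/
def differentClass : ClassGroup (𝓞 K) :=
  ClassGroup.mk0 ⟨differentIdeal ℤ (𝓞 K), mem_nonZeroDivisors_of_ne_zero (differentIdeal_int_ne_bot K)⟩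

/-- `C ↦ [𝔡_K] C⁻¹` is an involution of `Cl_K`. [folklore] -/
theorem involutive_differentClass_mul_inv :
    Function.Involutive (fun C : ClassGroup (𝓞 K) ↦ differentClass K * C⁻¹) := fun C ↦ by
  simp only [mul_inv_rev, inv_inv]
  rw [mul_comm C, ← mul_assoc, mul_inv_cancel, one_mul]

/-- **The duality involution** `σ(C) = [𝔡_K] C⁻¹` of the class group (Neukirch's pairing
`𝔎 𝔎' = [𝔡]` of VII (5.9)), as a permutation. [cite: NeukirchANT1999, Ch. VII (5.9)] -/
def dualityPerm : ClassGroup (𝓞 K) ≃ ClassGroup (𝓞 K) :=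
  (involutive_differentClass_mul_inv K).toPerm _

/-- `σ(C) = [𝔡_K] C⁻¹`. [folklore] -/
@[simp] theorem dualityPerm_apply (C : ClassGroup (𝓞 K)) : dualityPerm K C = differentClass K * C⁻¹ := rfl

/-- `σ⁻¹ = σ`. [folklore] -/
@[simp] theorem dualityPerm_symm : (dualityPerm K).symm = dualityPerm K := rfl

/-- `σ(σ(C)) = C`. [folklore] -/
theorem dualityPerm_dualityPerm (C : ClassGroup (𝓞 K)) : dualityPerm K (dualityPerm K C) = C :=
  involutive_differentClass_mul_inv K C

/-- The class of `dual 1 = 𝔡⁻¹` is `[𝔡_K]⁻¹`. [cite: NeukirchANT1999, Ch. VII (5.9)] -/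
theorem mk_dual_one :
    ClassGroup.mk K (Units.mk0 (FractionalIdeal.dual ℤ ℚ (1 : FractionalIdeal (𝓞 K)⁰ K))
      (FractionalIdeal.dual_ne_zero ℤ ℚ one_ne_zero)) = (differentClass K)⁻¹ := by
  rw [differentClass, ← ClassGroup.mk_mk0 K, ← map_inv]
  congr 1
  ext1
  rw [Units.val_inv_eq_inv_val, Units.val_mk0, FractionalIdeal.coe_mk0]
  change FractionalIdeal.dual ℤ ℚ 1 = ((((differentIdeal ℤ (𝓞 K) : Ideal (𝓞 K)) : FractionalIdeal (𝓞 K)⁰ K)))⁻¹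
  rw [coeIdeal_differentIdeal ℤ ℚ, inv_inv]

variable {K}

/-! ### The duals of the representatives, for the explicit `σ` -/

/-- **Duality of the representatives**: with `σ = dualityPerm K` there are `v_C ∈ K^×` such that
`dual(J_C) = (v_C) · J_{σ(C)}` for the representative `J_C` of `C⁻¹` (`classRep`), and
`𝔑(J_{σ C}) · |d_K| · 𝔑(J_C) · |N(v_C)| = 1` (as in the tree's `exists_classDuality`, whose
permutation is this `σ`). [cite: NeukirchANT1999, Ch. VII (5.10)] -/
theorem exists_dual_classRep_eq :
    ∃ v : ClassGroup (𝓞 K) → K, ∀ C, v C ≠ 0 ∧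
      FractionalIdeal.dual ℤ ℚ
          (((classRep K C : (Ideal (𝓞 K))⁰) : Ideal (𝓞 K)) : FractionalIdeal (𝓞 K)⁰ K) =
        FractionalIdeal.spanSingleton (𝓞 K)⁰ (v C) *
          (((classRep K (dualityPerm K C) : (Ideal (𝓞 K))⁰) : Ideal (𝓞 K)) : FractionalIdeal (𝓞 K)⁰ K) ∧
      (Ideal.absNorm (classRep K (dualityPerm K C) : Ideal (𝓞 K)) : ℚ) * (discr K).natAbs *
          Ideal.absNorm (classRep K C : Ideal (𝓞 K)) * |(Algebra.norm ℚ (v C) : ℚ)| = 1 := by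
  set δu : (FractionalIdeal (𝓞 K)⁰ K)ˣ := Units.mk0 (FractionalIdeal.dual ℤ ℚ (1 : FractionalIdeal (𝓞 K)⁰ K))
    (FractionalIdeal.dual_ne_zero ℤ ℚ one_ne_zero) with hδu
  have hδ : ClassGroup.mk K δu = (differentClass K)⁻¹ := mk_dual_one K
  have hJ0 : ∀ C : ClassGroup (𝓞 K),
      (((classRep K C : (Ideal (𝓞 K))⁰) : Ideal (𝓞 K)) : FractionalIdeal (𝓞 K)⁰ K) ≠ 0 := fun C ↦
    coeIdeal_ne_zero_of_mem_nonZeroDivisors (classRep K C)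
  have hmkJ : ∀ C : ClassGroup (𝓞 K),
      ClassGroup.mk K (FractionalIdeal.mk0 K (classRep K C)) = C⁻¹ := fun C ↦ by
    rw [ClassGroup.mk_mk0, mk0_classRep]
  have hdual : ∀ C : ClassGroup (𝓞 K),
      Units.mk0 _ (FractionalIdeal.dual_ne_zero ℤ ℚ (hJ0 C)) = δu * (FractionalIdeal.mk0 K (classRep K C))⁻¹ := by
    intro C
    ext1
    rw [Units.val_mul, Units.val_inv_eq_inv_val, Units.val_mk0, hδu, Units.val_mk0,
      FractionalIdeal.coe_mk0, FractionalIdeal.dual_eq_mul_inv ℤ ℚ]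
  have hmk : ∀ C : ClassGroup (𝓞 K),
      ClassGroup.mk K (Units.mk0 _ (FractionalIdeal.dual_ne_zero ℤ ℚ (hJ0 C))) =
        ClassGroup.mk K (FractionalIdeal.mk0 K (classRep K (dualityPerm K C))) := by
    intro C
    rw [hdual, map_mul, map_inv, hmkJ, hmkJ, inv_inv, hδ, dualityPerm_apply, mul_inv_rev, inv_inv, mul_comm]
  choose v hv0 hv using fun C ↦ exists_eq_spanSingleton_mul_of_mk_eq (hmk C)
  refine ⟨v, fun C ↦ ⟨hv0 C, ?_, ?_⟩⟩
  · have h := hv C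
    rw [Units.val_mk0, FractionalIdeal.coe_mk0] at h
    exact h
  · have h := hv C
    rw [Units.val_mk0, FractionalIdeal.coe_mk0] at h
    have hN := congr_arg FractionalIdeal.absNorm h
    rw [absNorm_dual, map_mul, FractionalIdeal.absNorm_span_singleton, FractionalIdeal.coeIdeal_absNorm,
      FractionalIdeal.coeIdeal_absNorm] at hN
    have hC : (Ideal.absNorm (classRep K C : Ideal (𝓞 K)) : ℚ) ≠ 0 :=
      Nat.cast_ne_zero.mpr (Ideal.absNorm_pos_of_nonZeroDivisors (classRep K C)).ne'
    have hd : ((discr K).natAbs : ℚ) ≠ 0 :=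
      Nat.cast_ne_zero.mpr (Int.natAbs_ne_zero.mpr (discr_ne_zero K))
    field_simp at hN
    linear_combination -hN

/-! ### The functional equation with the explicit permutation -/

/-- **`Λ_a(1 − s) = Λ_{a ∘ σ}(s)`** off the integers, `σ = dualityPerm K` (`= σ⁻¹`), for every
coefficient function `a : Cl_K → ℂ` — the tree's `exists_perm_completedClassTwistedZeta_one_sub`,
same proof, with the explicit duality. [cite: NeukirchANT1999, Ch. VII (5.10), (8.6)] -/
theorem completedClassTwistedZeta_one_sub (a : ClassGroup (𝓞 K) → ℂ) {s : ℂ} (hs : ∀ n : ℤ, s ≠ n) :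
    completedClassTwistedZeta K a (1 - s) = completedClassTwistedZeta K (a ∘ dualityPerm K) s := by
  have hinv := thetaIdeal_inv_holds K
  obtain ⟨v, hσv⟩ := exists_dual_classRep_eq (K := K)
  set σ := dualityPerm K with hσdef
  have hsZ : ∀ w : ℂ, (∀ n : ℤ, w ≠ n) → w ≠ 0 ∧ w ≠ 1 := fun w hw ↦
    ⟨by simpa using hw 0, by simpa using hw 1⟩
  have hs' : ∀ n : ℤ, 1 - s ≠ n := fun n h ↦
    hs (1 - n) (by rw [← sub_sub_cancel 1 s, h]; push_cast; ring)
  obtain ⟨hs0, hs1⟩ := hsZ s hs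
  set d : ℂ := ((discr K).natAbs : ℂ) with hd
  set N : ClassGroup (𝓞 K) → ℂ := fun C ↦ (Ideal.absNorm (classRep K C : Ideal (𝓞 K)) : ℂ) with hN
  set L : ClassGroup (𝓞 K) → ℂ → ℂ := fun C z ↦ (classPair hinv C).Λ z with hL
  have hJ0 : ∀ C : ClassGroup (𝓞 K), (((classRep K C : (Ideal (𝓞 K))⁰) : Ideal (𝓞 K)) :
      FractionalIdeal (𝓞 K)⁰ K) ≠ 0 := fun C ↦ coeIdeal_ne_zero_of_mem_nonZeroDivisors (classRep K C)
  -- Step 1: `Λ_b(w) = 2^{r₂} c⁻¹ w⁻¹ ∑_C b(C) d^{w/2} N_C^w Λ_C(w/2)` off the integers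
  have hΛK : ∀ (b : ClassGroup (𝓞 K) → ℂ) (w : ℂ), (∀ n : ℤ, w ≠ n) →
      completedClassTwistedZeta K b w =
        2 ^ nrComplexPlaces K * ((heckeCst K : ℂ))⁻¹ * ((torsionOrder K : ℂ))⁻¹ *
          ∑ C, b C * (d ^ (w / 2) * N C ^ w * L C (w / 2)) := by
    intro b w hw
    obtain ⟨hw0, hw1⟩ := hsZ w hw
    rw [completedClassTwistedZeta, classTwistedZeta, dedekindGammaFactor_eq, Finset.mul_sum,
      Finset.mul_sum]
    refine Finset.sum_congr rfl fun C _ ↦ ?_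
    have hA := gammaFactorC_half_ne_zero (K := K) hw
    rw [classSumCont_eq_mul_Λ hinv C hw0]
    simp only [hd, hN, hL, classFrontFactor]
    field_simp
  -- Step 2: the functional equation of each class, moved to the representative of `σ C`
  have hFE : ∀ C, L C ((1 - s) / 2) = (classPair hinv C).ε *
      (((|(Algebra.norm ℚ (v C) : ℚ)| : ℝ) : ℂ) ^ (-s) * L (σ C) (s / 2)) := by
    intro C
    have h1 := (classPair hinv C).functional_equation (s / 2)
    have hk : ((classPair hinv C).k : ℂ) - s / 2 = (1 - s) / 2 := by
      show ((1 / 2 : ℝ) : ℂ) - s / 2 = (1 - s) / 2; push_cast; ring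
    rw [hk, smul_eq_mul] at h1
    simp only [hL]
    rw [h1]
    congr 1
    have h2 : (classPair hinv C).symm = heckePair K hinv (FractionalIdeal.dual ℤ ℚ _)
        (FractionalIdeal.dual_ne_zero ℤ ℚ (hJ0 C)) := heckePair_symm hinv _ (hJ0 C)
    have hxI : FractionalIdeal.spanSingleton (𝓞 K)⁰ (v C) *
        (((classRep K (σ C) : (Ideal (𝓞 K))⁰) : Ideal (𝓞 K)) : FractionalIdeal (𝓞 K)⁰ K) ≠ 0 :=
      mul_ne_zero (FractionalIdeal.spanSingleton_ne_zero_iff.mpr (hσv C).1) (hJ0 (σ C))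
    have hz0 : s / 2 ≠ 0 := div_ne_zero hs0 two_ne_zero
    have hzk : s / 2 ≠ ((1 / 2 : ℝ) : ℂ) := by
      intro h; apply hs1
      have := congr_arg (fun z : ℂ ↦ 2 * z) h
      push_cast at this
      linear_combination this
    rw [h2, heckePair_congr hinv (hσv C).2.1 _ hxI,
      heckePair_Λ_spanSingleton_mul hinv (hσv C).1 _ (hJ0 (σ C)) hxI hz0 hzk,
      show -(2 * (s / 2)) = -s by ring]
    rfl
  -- Step 3: the coefficients match after re-indexing
  have hcoef : ∀ C, d ^ ((1 - s) / 2) * N C ^ (1 - s) * ((classPair hinv C).ε *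
      (((|(Algebra.norm ℚ (v C) : ℚ)| : ℝ) : ℂ) ^ (-s))) = d ^ (s / 2) * N (σ C) ^ s := by
    intro C
    have hnC : (0 : ℝ) < Ideal.absNorm (classRep K C : Ideal (𝓞 K)) :=
      Nat.cast_pos.mpr (Ideal.absNorm_pos_of_nonZeroDivisors (classRep K C))
    have hnD : (0 : ℝ) < Ideal.absNorm (classRep K (σ C) : Ideal (𝓞 K)) :=
      Nat.cast_pos.mpr (Ideal.absNorm_pos_of_nonZeroDivisors (classRep K (σ C)))
    have hdn : (0 : ℝ) < (discr K).natAbs := Nat.cast_pos.mpr (Int.natAbs_pos.mpr (discr_ne_zero K))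
    have hav : (0 : ℝ) < |((Algebra.norm ℚ (v C) : ℚ) : ℝ)| := by
      have : (Algebra.norm ℚ (v C) : ℚ) ≠ 0 := Algebra.norm_ne_zero_iff.mpr (hσv C).1
      positivity
    have hprod : (Ideal.absNorm (classRep K (σ C) : Ideal (𝓞 K)) : ℝ) * (discr K).natAbs *
        Ideal.absNorm (classRep K C : Ideal (𝓞 K)) * |((Algebra.norm ℚ (v C) : ℚ) : ℝ)| = 1 := by
      have := congr_arg (Rat.cast : ℚ → ℝ) (hσv C).2.2
      push_cast at this
      exact this
    have hlog : Real.log (Ideal.absNorm (classRep K (σ C) : Ideal (𝓞 K))) +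
        Real.log ((discr K).natAbs) + Real.log (Ideal.absNorm (classRep K C : Ideal (𝓞 K))) +
        Real.log |((Algebra.norm ℚ (v C) : ℚ) : ℝ)| = 0 := by
      have := congr_arg Real.log hprod
      rwa [Real.log_mul (by positivity) hav.ne', Real.log_mul (by positivity) hnC.ne',
        Real.log_mul hnD.ne' hdn.ne', Real.log_one] at this
    have hlogC := congr_arg (fun x : ℝ ↦ (x : ℂ)) hlog
    simp only [Complex.ofReal_add, Complex.ofReal_zero] at hlogC
    have hd' : d = (((discr K).natAbs : ℝ) : ℂ) := by rw [hd, Complex.ofReal_natCast]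
    have hNC : N C = ((Ideal.absNorm (classRep K C : Ideal (𝓞 K)) : ℝ) : ℂ) := by
      rw [hN]; simp only [Complex.ofReal_natCast]
    have hND : N (σ C) = ((Ideal.absNorm (classRep K (σ C) : Ideal (𝓞 K)) : ℝ) : ℂ) := by
      rw [hN]; simp only [Complex.ofReal_natCast]
    rw [hd', hNC, hND, ofReal_cpow_eq_exp hdn, ofReal_cpow_eq_exp hdn, ofReal_cpow_eq_exp hnC,
      ofReal_cpow_eq_exp hnD, ofReal_cpow_eq_exp hav, classPair_ε_eq_exp hinv C,
      ← Complex.exp_add, ← Complex.exp_add, ← Complex.exp_add, ← Complex.exp_add]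
    congr 1
    linear_combination (-s) * hlogC
  -- Step 4: assemble, re-indexing the classes by `σ` (`σ⁻¹ = σ`)
  rw [hΛK a (1 - s) hs', hΛK (a ∘ σ) s hs]
  congr 1
  calc ∑ C, a C * (d ^ ((1 - s) / 2) * N C ^ (1 - s) * L C ((1 - s) / 2))
      = ∑ C, (a ∘ σ) (σ C) * (d ^ (s / 2) * N (σ C) ^ s * L (σ C) (s / 2)) := by
        refine Finset.sum_congr rfl fun C _ ↦ ?_
        rw [Function.comp_apply, hσdef, dualityPerm_dualityPerm, ← hσdef, hFE C, ← hcoef C]; ring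
    _ = ∑ C, (a ∘ σ) C * (d ^ (s / 2) * N C ^ s * L C (s / 2)) :=
        σ.sum_comp (fun C ↦ (a ∘ σ) C * (d ^ (s / 2) * N C ^ s * L C (s / 2)))

/-! ### The closed form for characters: the root number `χ([𝔡_K])` -/

/-- `Z_{c·a} = c · Z_a` (linearity of the class-twisted zeta function in `a`). [folklore] -/
theorem classTwistedZeta_const_mul (c : ℂ) (a : ClassGroup (𝓞 K) → ℂ) (s : ℂ) :
    classTwistedZeta K (fun C ↦ c * a C) s = c * classTwistedZeta K a s := by
  rw [classTwistedZeta, classTwistedZeta, Finset.mul_sum]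
  exact Finset.sum_congr rfl fun C _ ↦ by ring

/-- `χ ∘ σ = χ([𝔡_K]) · χ⁻¹`. [folklore] -/
theorem classGroupChar_comp_dualityPerm (χ : ClassGroup (𝓞 K) →* ℂˣ) :
    (fun C ↦ (χ C : ℂ)) ∘ dualityPerm K = fun C ↦ (χ (differentClass K) : ℂ) * (χ⁻¹ C : ℂ) := by
  funext C
  simp only [Function.comp_apply, dualityPerm_apply, map_mul, map_inv, Units.val_mul, MonoidHom.inv_apply]

/-- **Functional equation of `L(s, χ)` in closed form** (Neukirch VII (8.6), `𝔪 = 1`;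
[ThornerZaman2019, (2.6)] with `𝔣_χ = 1`): for a class group character `χ` and `s ∉ ℤ`,
`Λ(1 − s, χ) = χ([𝔡_K]) · Λ(s, χ⁻¹)`, `Λ(s, χ) = |d_K|^{s/2} Γ_ℝ(s)^{r₁} Γ_ℂ(s)^{r₂} L(s, χ)` — the
root number of an everywhere unramified character is `W(χ) = χ(𝔡_K)`.
[cite: NeukirchANT1999, Ch. VII (8.6)] -/
theorem completedClassGroupLFunction_one_sub (χ : ClassGroup (𝓞 K) →* ℂˣ) {s : ℂ} (hs : ∀ n : ℤ, s ≠ n) :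
    dedekindGammaFactor K (1 - s) * classGroupLFunction K χ (1 - s) =
      (χ (differentClass K) : ℂ) * (dedekindGammaFactor K s * classGroupLFunction K χ⁻¹ s) := by
  have h := completedClassTwistedZeta_one_sub (K := K) (fun C ↦ (χ C : ℂ)) hs
  rw [classGroupChar_comp_dualityPerm] at h
  rw [classGroupLFunction_eq_classTwistedZeta, classGroupLFunction_eq_classTwistedZeta,
    ← completedClassTwistedZeta, h, completedClassTwistedZeta, classTwistedZeta_const_mul]
  ring

/-- `|χ([𝔡_K])| = 1`. [folklore] -/
theorem norm_rootNumber (χ : ClassGroup (𝓞 K) →* ℂˣ) : ‖(χ (differentClass K) : ℂ)‖ = 1 :=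
  norm_classGroupChar_apply χ _

end Literature.NumberTheory.LFunctions.NumberField

end
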